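import Mathlib
import Literature.Geometry.DiscreteGeometry.TwoShellChartTemplate
import Summits.AtomisticToContinuum.Crystallization.Theorems.NashClassCertificatesNashNearFieldStubChartCoreBridge
import Summits.AtomisticToContinuum.Crystallization.Theorems.PhononSlackCertificatesNearFieldConvexityStubChartSites
import Summits.AtomisticToContinuum.Crystallization.Theorems.NashClassCertificatesNashNearFieldStubLabelledPlacementPlace

/-!
# Crux `NashClassCertificates.NashNearField` (stmt-AtomisticToContinuum-16827), line `birth`,
# stub `stub_labelledPlacement` — soundness V: from the LEAF GOAL to the labelled placement (normalised frame)

At an accepted leaf the context `κ` gives the frame `ctxFrame κ` and the Hägg word `ctxWord κ`; the bridge checks give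
clauses (i) and (ii) of the stub (the centre's pattern consists exactly of the non-zero central template sites, (ii) through
the integer norm `12‖·‖²` of `chartSites_normSq_eq` and the finite ranges of `chartSites_bounds`); and every described table
passing `leafTableOK` gives an injective, adjacent site labelling of its pivot's pattern with the metric alternative
(`leafGoal_placement`): the entry of a label sits exactly at a template site (`P = d • z`), adjacent to the pivot
(`0 < sq (z − v) ≤ 40`), within `num/(940 d) ≤ 2/5` of the particle — unless the site is far (`sq z ≥ 84`, i.e. norm
`> 43/20`, and farther than `100/47 + E`, so that the particle has norm `> 100/47`).
-/

noncomputable section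

open Literature.Geometry.DiscreteGeometry Literature.Geometry.DiscreteGeometry.TwoShellCheck
  Literature.Geometry.DiscreteGeometry.TwoShellChart Literature.MathematicalPhysics.StatisticalMechanics

namespace Summit.AtomisticToContinuum.Crystallization.Theorems.NashClassCertificatesNashNearField

open Summit.AtomisticToContinuum.Crystallization.Theorems.PhononSlackNearFieldConvexity
  (chartSites_normSq_eq chartSites_bounds)

variable {ι : Type*} {cen : List IVec} {pos : ι → EuclideanSpace ℝ (Fin 3)} {i₀ : ι} {fC : IVec → ι}

/-! ### Boolean vocabulary -/

/-- `veq` is equality. -/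
theorem veq_iff (a b : IVec) : veq a b = true ↔ a = b := by
  obtain ⟨a1, a2, a3⟩ := a; obtain ⟨b1, b2, b3⟩ := b
  simp [veq, Prod.ext_iff]
  tauto

/-- `lmem` is membership. -/
theorem lmem_iff (z : IVec) (l : List IVec) : lmem z l = true ↔ z ∈ l := by
  unfold lmem
  rw [List.any_eq_true]
  constructor
  · rintro ⟨w, hw, h⟩; rw [veq_iff] at h; rw [← h]; exact hw
  · intro h; exact ⟨z, h, (veq_iff z z).2 rfl⟩

/-- Indexed access to an `all` over a `zip`. -/
theorem all_zip_getElem {α β : Type*} {l : List α} {m : List β} {f : α × β → Bool}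
    (h : (List.zip l m).all f = true) (k : ℕ) (hk : k < l.length) (hk' : k < m.length) : f (l[k], m[k]) = true := by
  rw [List.all_eq_true] at h
  apply h
  rw [List.mem_iff_getElem]
  exact ⟨k, by rw [List.length_zip]; exact lt_min hk hk', by rw [List.getElem_zip]⟩

/-- `pairwiseDistinct` means `Nodup`. -/
theorem nodup_of_pairwiseDistinct : ∀ {l : List IVec}, pairwiseDistinct l = true → l.Nodup
  | [], _ => List.nodup_nil
  | z :: l, h => by
    unfold pairwiseDistinct at h
    rw [Bool.and_eq_true, List.all_eq_true] at h
    refine List.nodup_cons.2 ⟨fun hz => ?_, nodup_of_pairwiseDistinct h.2⟩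
    have := h.1 z hz
    simp [(veq_iff z z).2 rfl] at this

/-! ### Geometry of sites -/

/-- A site adjacent to the pivot in the integer test: distinct from it and within `3/2`. -/
theorem adjacent_of_sq {z v : IVec} (h0 : 0 < TwoShellCheck.sq (vsub z v)) (h40 : TwoShellCheck.sq (vsub z v) ≤ 40) :
    pt z ≠ pt v ∧ dist (pt z) (pt v) ≤ 3 / 2 := by
  have hsq := norm_pt_sub_sq z v
  constructor
  · intro heq
    rw [heq, sub_self, norm_zero] at hsq
    have : (TwoShellCheck.sq (vsub z v) : ℝ) = 0 := by linarith
    have : TwoShellCheck.sq (vsub z v) = 0 := by exact_mod_cast this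
    omega
  · rw [dist_eq_norm]
    have h40' : (TwoShellCheck.sq (vsub z v) : ℝ) ≤ 40 := by exact_mod_cast h40
    have : ‖pt z - pt v‖ ^ 2 ≤ (3 / 2) ^ 2 := by rw [hsq]; linarith
    exact abs_le_of_sq_le_sq' this (by norm_num) |>.2

/-- Cancelling a positive integer factor of triples. -/
theorem vsmul_cancel {d : ℤ} (hd : 0 < d) {z y : IVec} (h : vsmul d z = vsmul d y) : z = y := by
  obtain ⟨a, b, c⟩ := z; obtain ⟨a', b', c'⟩ := y
  simp only [vsmul, Prod.mk.injEq] at h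
  exact Prod.ext (mul_left_cancel₀ hd.ne' h.1) (Prod.ext (mul_left_cancel₀ hd.ne' h.2.1) (mul_left_cancel₀ hd.ne' h.2.2))

/-- **The metric alternative.**  An entry bounding the particle `k`, sitting exactly at the site `z` (`P = d • z`,
`d > 0`) and passing `metricOK`, gives `‖pos k − pt z‖ ≤ 2/5` whenever `‖pt z‖ ≤ 43/20` or `‖pos k‖ ≤ 100/47`. -/
theorem metric_of_metricOK {k : ι} {e : Entry} {z : IVec} (hb : EntryBound (pos k) e)
    (hP : vsmul e.2.1 z = e.1) (hd : 0 < e.2.1) (hm : metricOK e z = true)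
    (hcond : ‖pt z‖ ≤ 43 / 20 ∨ ‖pos k‖ ≤ 100 / 47) : ‖pos k - pt z‖ ≤ 2 / 5 := by
  obtain ⟨P, d, num⟩ := e
  simp only at hP hd hb hm
  obtain ⟨-, hbd⟩ := hb
  simp only at hbd
  have hdR : (0 : ℝ) < d := by exact_mod_cast hd
  have hpt : ((d : ℝ))⁻¹ • pt P = pt z := by
    rw [← hP, pt_vsmul, smul_smul, inv_mul_cancel₀ hdR.ne', one_smul]
  rw [hpt, abs_of_pos hdR] at hbd
  -- `E = num/(940 d)`
  set E := (num : ℝ) / (940 * d) with hE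
  unfold metricOK at hm
  rw [Bool.or_eq_true, Bool.and_eq_true, decide_eq_true_eq, decide_eq_true_eq, decide_eq_true_eq] at hm
  rcases hm with hle | ⟨h84, hfar⟩
  · -- `E ≤ 2/5`
    have : E ≤ 2 / 5 := by
      rw [hE, div_le_iff₀ (by positivity)]
      have : ((5 * num : ℤ) : ℝ) ≤ ((2 * 940 * zabs d : ℤ) : ℝ) := by exact_mod_cast hle
      push_cast at this
      rw [cast_zabs, abs_of_pos hdR] at this
      linarith
    exact hbd.trans this
  · -- the far branch contradicts the condition
    exfalso
    have hz : (84 : ℝ) ≤ TwoShellCheck.sq z := by exact_mod_cast h84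
    have hnz : (43 / 20 : ℝ) < ‖pt z‖ := by
      have h2 := norm_pt_sq z
      have : (43 / 20 : ℝ) ^ 2 < ‖pt z‖ ^ 2 := by rw [h2]; nlinarith
      exact lt_of_pow_lt_pow_left₀ 2 (norm_nonneg _) this
    have hfar' : (TwoShellCheck.sq z : ℝ) * ((47 * 940 * d) * (47 * 940 * d)) >
        18 * ((100 * 940 * d + 47 * num) * (100 * 940 * d + 47 * num)) := by
      have h' : ((TwoShellCheck.sq z * (47 * 940 * zabs d * (47 * 940 * zabs d)) : ℤ) : ℝ) >
          ((18 * ((100 * 940 * zabs d + 47 * num) * (100 * 940 * zabs d + 47 * num)) : ℤ) : ℝ) := by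
        exact_mod_cast hfar
      push_cast at h'
      rw [cast_zabs, abs_of_pos hdR] at h'
      linarith
    -- hence `‖pt z‖ > 100/47 + E`
    have hbig : 100 / 47 + E < ‖pt z‖ := by
      have h2 := norm_pt_sq z
      have hsum : (100 / 47 + E) = (100 * 940 * d + 47 * num) / (47 * 940 * d) := by
        rw [hE]; field_simp
      by_cases hneg : 100 * 940 * (d : ℝ) + 47 * num < 0
      · have : 100 / 47 + E < 0 := by rw [hsum]; exact div_neg_of_neg_of_pos hneg (by positivity)
        linarith [norm_nonneg (pt z)]
      · push Not at hneg
        have hpos : 0 ≤ 100 / 47 + E := by rw [hsum]; positivity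
        have : (100 / 47 + E) ^ 2 < ‖pt z‖ ^ 2 := by
          rw [hsum, h2, div_pow, div_lt_div_iff₀ (by positivity) (by norm_num)]
          nlinarith
        exact lt_of_pow_lt_pow_left₀ 2 (norm_nonneg _) this
    rcases hcond with hc | hc
    · linarith
    · have : ‖pt z‖ ≤ ‖pos k‖ + ‖pos k - pt z‖ := by
        calc ‖pt z‖ = ‖pos k - (pos k - pt z)‖ := by congr 1; abel
          _ ≤ ‖pos k‖ + ‖pos k - pt z‖ := norm_sub_le _ _
      linarith

/-! ### The bridge clauses from `bridgeOK` -/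

/-- **Clause (i)**: every point of the centre's pattern is the frame image of a template site. -/
theorem bridge_i {κ : TwoShellChart.Ctx} {witI : List (ℤ × ℤ × ℤ)} (h : bridgeOK cen κ witI = true) :
    ∀ c ∈ cen, ∃ m u w : ℤ, ctxFrame κ (barlowPos 1 (Real.sqrt 6 / 3) (ctxWord κ) m u w) = pt c := by
  unfold bridgeOK at h
  simp only [Bool.and_eq_true, beq_iff_eq] at h
  obtain ⟨⟨⟨hlen, hlay⟩, hzip⟩, -⟩ := h
  intro c hc
  obtain ⟨k, hk, rfl⟩ := List.mem_iff_getElem.1 hc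
  have hk' : k < witI.length := by omega
  have hz := all_zip_getElem hzip k hk hk'
  rw [veq_iff] at hz
  have hl : layerOK (witI[k]) = true := by rw [List.all_eq_true] at hlay; exact hlay _ (List.getElem_mem hk')
  unfold layerOK at hl
  simp only [Bool.and_eq_true, decide_eq_true_eq] at hl
  exact ⟨(witI[k]).1, (witI[k]).2.1, (witI[k]).2.2, by rw [ctxFrame_barlowPos κ hl]; exact congrArg pt hz⟩

/-- **Clause (ii)**: every non-zero template site of norm `≤ 3/2` is carried into the centre's pattern. -/
theorem bridge_ii {κ : TwoShellChart.Ctx} (hv : ctxValid κ = true) {witI : List (ℤ × ℤ × ℤ)} (h : bridgeOK cen κ witI = true)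
    {m u w : ℤ} (hle : ‖barlowPos 1 (Real.sqrt 6 / 3) (ctxWord κ) m u w‖ ≤ 3 / 2)
    (hne : barlowPos 1 (Real.sqrt 6 / 3) (ctxWord κ) m u w ≠ 0) :
    ∃ c ∈ cen, ctxFrame κ (barlowPos 1 (Real.sqrt 6 / 3) (ctxWord κ) m u w) = pt c := by
  unfold bridgeOK at h
  simp only [Bool.and_eq_true] at h
  obtain ⟨-, hall⟩ := h
  -- the integer norm
  set L := haggLabel (ctxWord κ) m with hL
  have hN := chartSites_normSq_eq (ctxWord κ) m u w
  have h27 := int_le_27_of_norm_le hN hle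
  have hm1 := layer_mem_Icc_of_int_le h27
  obtain ⟨hma, hmb⟩ := Finset.mem_Icc.1 hm1
  have hLr := haggLabel_ctxWord_small κ hv ⟨hma, hmb⟩
  rw [← hL] at hLr h27 hN
  obtain ⟨hu, hw⟩ := chartSites_bounds (u := u) (v := w) (L := L) (m := m) ⟨by omega, by omega⟩ (h27.trans (by norm_num))
  obtain ⟨hua, hub⟩ := Finset.mem_Icc.1 hu
  obtain ⟨hwa, hwb⟩ := Finset.mem_Icc.1 hw
  have h1 : 1 ≤ 3 * (2 * u + w + L) ^ 2 + (3 * w + L) ^ 2 + 8 * m ^ 2 := by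
    by_contra hlt
    push Not at hlt
    have h0 : (12 : ℝ) * ‖barlowPos 1 (Real.sqrt 6 / 3) (ctxWord κ) m u w‖ ^ 2 ≤ 0 := by
      rw [hN]; exact_mod_cast (by omega : 3 * (2 * u + w + L) ^ 2 + (3 * w + L) ^ 2 + 8 * m ^ 2 ≤ 0)
    have : ‖barlowPos 1 (Real.sqrt 6 / 3) (ctxWord κ) m u w‖ = 0 := by nlinarith [norm_nonneg (barlowPos 1 (Real.sqrt 6 / 3) (ctxWord κ) m u w)]
    exact hne (norm_eq_zero.1 this)
  -- instantiate the finite check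
  rw [List.all_eq_true] at hall
  have hm' : m ∈ ([-1, 0, 1] : List ℤ) := by simp; omega
  have h2 := hall m hm'
  rw [List.all_eq_true] at h2
  have hu' : u ∈ (List.range 11).map (fun i : ℕ => (i : ℤ) - 5) := by
    rw [List.mem_map]; exact ⟨(u + 5).toNat, List.mem_range.2 (by omega), by omega⟩
  have h3 := h2 u hu'
  rw [List.all_eq_true] at h3
  have hw' : w ∈ (List.range 7).map (fun i : ℕ => (i : ℤ) - 3) := by
    rw [List.mem_map]; exact ⟨(w + 3).toNat, List.mem_range.2 (by omega), by omega⟩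
  have h4 := h3 w hw'
  simp only [Bool.or_eq_true, Bool.not_eq_true', Bool.and_eq_false_iff, decide_eq_false_iff_not] at h4
  have hwl : wordLabel κ m = L := by rw [hL, haggLabel_ctxWord κ ⟨by omega, by omega⟩]
  rw [hwl] at h4
  rcases h4 with (h4 | h4) | h4
  · exfalso; apply h4; nlinarith
  · exfalso; apply h4; nlinarith
  · rw [lmem_iff] at h4
    exact ⟨_, h4, by rw [ctxFrame_barlowPos κ ⟨by omega, by omega⟩]⟩

/-! ### The placement of one pivot from its leaf table -/

/-- Unpacking `leafEntryOK`. -/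
theorem leafEntryOK_iff (p : IVec) (e : Entry) (z : IVec) : leafEntryOK p e z = true ↔
    vsmul e.2.1 z = e.1 ∧ 0 < e.2.1 ∧ 0 < TwoShellCheck.sq (vsub z p) ∧ TwoShellCheck.sq (vsub z p) ≤ 40 ∧ metricOK e z = true := by
  unfold leafEntryOK
  simp only [Bool.and_eq_true, decide_eq_true_eq, veq_iff]
  tauto

/-- **The labelled placement of a pivot** from a described table passing the leaf check. -/
theorem leafGoal_placement {W : PivotW ι} {κ : TwoShellChart.Ctx} {p : IVec} {T : List Entry} {wit : List (ℤ × ℤ × ℤ)}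
    (hT : TableDescribes pos W T) (hleaf : leafTableOK κ p T wit = true) :
    ∃ σ : IVec → ℤ × ℤ × ℤ,
      Set.InjOn (fun w => barlowPos 1 (Real.sqrt 6 / 3) (ctxWord κ) (σ w).1 (σ w).2.1 (σ w).2.2)
        {w | w ∈ modelList W.t} ∧
      ∀ w ∈ modelList W.t,
        ctxFrame κ (barlowPos 1 (Real.sqrt 6 / 3) (ctxWord κ) (σ w).1 (σ w).2.1 (σ w).2.2) ≠ pt p ∧
        dist (ctxFrame κ (barlowPos 1 (Real.sqrt 6 / 3) (ctxWord κ) (σ w).1 (σ w).2.1 (σ w).2.2)) (pt p) ≤ 3 / 2 ∧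
        ((‖barlowPos 1 (Real.sqrt 6 / 3) (ctxWord κ) (σ w).1 (σ w).2.1 (σ w).2.2‖ ≤ 43 / 20 ∨ ‖pos (W.fP w)‖ ≤ 100 / 47) →
          ‖pos (W.fP w) - ctxFrame κ (barlowPos 1 (Real.sqrt 6 / 3) (ctxWord κ) (σ w).1 (σ w).2.1 (σ w).2.2)‖ ≤ 2 / 5) := by
  classical
  obtain ⟨eo, hperm, hb⟩ := hT
  unfold leafTableOK at hleaf
  simp only [Bool.and_eq_true, beq_iff_eq] at hleaf
  obtain ⟨⟨⟨hlen, hlay⟩, hzip⟩, hpd⟩ := hleaf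
  have hsl : (leafSites κ wit).length = wit.length := by simp [leafSites]
  have hnd := nodup_of_pairwiseDistinct hpd
  -- facts at an index
  have hidx : ∀ k (hk : k < T.length), ∃ (hk' : k < wit.length),
      leafEntryOK p (T[k]) (ctxSite κ (wit[k]).1 (wit[k]).2.1 (wit[k]).2.2) = true ∧
      (-2 ≤ (wit[k]).1 ∧ (wit[k]).1 ≤ 2) := by
    intro k hk
    have hk' : k < wit.length := by omega
    refine ⟨hk', ?_, ?_⟩
    · have := all_zip_getElem hzip k hk (by rw [hsl]; exact hk')
      simpa [leafSites] using this
    · rw [List.all_eq_true] at hlay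
      have := hlay _ (List.getElem_mem hk')
      unfold layerOK at this
      simpa using this
  -- the entries of `T` are pairwise distinct (their sites are)
  have hTnd : T.Nodup := by
    rw [List.nodup_iff_injective_get]
    intro a b hab
    obtain ⟨ha', hEa, _⟩ := hidx a.1 a.2
    obtain ⟨hb', hEb, _⟩ := hidx b.1 b.2
    rw [leafEntryOK_iff] at hEa hEb
    simp only [List.get_eq_getElem] at hab
    have hz : ctxSite κ (wit[a.1]).1 (wit[a.1]).2.1 (wit[a.1]).2.2 =
        ctxSite κ (wit[b.1]).1 (wit[b.1]).2.1 (wit[b.1]).2.2 := by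
      have e1 := hEa.1
      have e2 := hEb.1
      rw [hab] at e1
      rw [← e2] at e1
      exact vsmul_cancel hEb.2.1 e1
    have hget : (leafSites κ wit).get ⟨a.1, by rw [hsl]; exact ha'⟩ = (leafSites κ wit).get ⟨b.1, by rw [hsl]; exact hb'⟩ := by
      simp only [List.get_eq_getElem]; simpa [leafSites] using hz
    have := List.nodup_iff_injective_get.1 hnd hget
    exact Fin.ext (by simpa using this)
  -- `eo` is injective on the labels
  have hmapnd : ((modelList W.t).map eo).Nodup := hperm.nodup_iff.2 hTnd
  have heo_inj : ∀ w ∈ modelList W.t, ∀ w' ∈ modelList W.t, eo w = eo w' → w = w' := fun w hw w' hw' h =>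
    List.inj_on_of_nodup_map hmapnd hw hw' h
  -- the labelling
  let σ : IVec → ℤ × ℤ × ℤ := fun w => wit.getD (T.idxOf (eo w)) (0, 0, 0)
  have hσ : ∀ w ∈ modelList W.t, ∃ (k : ℕ) (hk : k < T.length) (hk' : k < wit.length),
      T[k] = eo w ∧ σ w = wit[k] := by
    intro w hw
    have hmem : eo w ∈ T := hperm.mem_iff.1 (List.mem_map_of_mem hw)
    have hk : T.idxOf (eo w) < T.length := List.idxOf_lt_length_of_mem hmem
    refine ⟨T.idxOf (eo w), hk, by omega, List.getElem_idxOf hk, ?_⟩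
    simp only [σ]
    rw [List.getD_eq_getElem _ _ (by omega)]
  refine ⟨σ, ?_, ?_⟩
  · -- injectivity
    intro w hw w' hw' heq
    simp only [Set.mem_setOf_eq] at hw hw'
    simp only at heq
    obtain ⟨k, hk, hk', hTk, hσk⟩ := hσ w hw
    obtain ⟨k', hk2, hk2', hTk', hσk'⟩ := hσ w' hw'
    obtain ⟨hkw, -, hl⟩ := hidx k hk
    obtain ⟨hkw', -, hl'⟩ := hidx k' hk2
    rw [hσk, hσk'] at heq
    have h1 := congrArg (ctxFrame κ) heq
    rw [ctxFrame_barlowPos κ hl, ctxFrame_barlowPos κ hl'] at h1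
    have h2 := pt_injective h1
    -- equal sites ⇒ equal indices ⇒ equal entries ⇒ equal labels
    have hkk : k = k' := by
      have hget : (leafSites κ wit).get ⟨k, by rw [hsl]; exact hk'⟩ = (leafSites κ wit).get ⟨k', by rw [hsl]; exact hk2'⟩ := by
        simp only [List.get_eq_getElem]; simpa [leafSites] using h2
      have := List.nodup_iff_injective_get.1 hnd hget
      simpa using this
    subst hkk
    exact heo_inj w hw w' hw' (hTk.symm.trans hTk')
  · intro w hw
    obtain ⟨k, hk, hk', hTk, hσk⟩ := hσ w hw
    obtain ⟨hkw, hE, hl⟩ := hidx k hk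
    rw [hTk, leafEntryOK_iff] at hE
    obtain ⟨hP, hd, h0, h40, hm⟩ := hE
    rw [hσk, ctxFrame_barlowPos κ hl]
    obtain ⟨hne, hdist⟩ := adjacent_of_sq h0 h40
    refine ⟨hne, hdist, fun hcond => metric_of_metricOK (hb w hw) hP hd hm ?_⟩
    rcases hcond with hc | hc
    · left
      rwa [← (ctxFrame κ).norm_map, ctxFrame_barlowPos κ hl] at hc
    · exact Or.inr hc

/-- **Registered sub-goal `stub_labelledPlacementDistinct` of crux stmt-AtomisticToContinuum-16827** (landing anchor of this file,
re-exporting `nodup_of_pairwiseDistinct`). -/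
theorem stub_labelledPlacementDistinct : ∀ (l : List Literature.Geometry.DiscreteGeometry.TwoShellCheck.IVec), Literature.Geometry.DiscreteGeometry.TwoShellChart.pairwiseDistinct l = true → l.Nodup :=
  fun _ h => nodup_of_pairwiseDistinct h

end Summit.AtomisticToContinuum.Crystallization.Theorems.NashClassCertificatesNashNearField

end
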